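import Summits.Ventures.HSemireg.Mod4LeadingTermPinsNearSelfDual
import Summits.Ventures.HSemireg.Mod4TwoZeroPivots

/-!
# Venture HSemireg — MOD-4 line: the UNIFORM even-`n` pin criterion for the `ch(O_Z)`-SHAPE rows — at EVERY pin
# `t_a = C(n,a)² q_n²` (`a < n/2`, block size `k = n − 2a`) the drop is `2` iff ONE `k × k` determinant vanishes, else `1`

HONEST FRAMING. Part of the Lean index of the computation cell `pub-hsemireg` (seat w3-mod4-1 gen 15, W3 SPECIAL FIBRES; file of
record `HOME/widen/W3/MOD4-OFFSPLIT-w3mod4.md` §13.30, last sentence, and §13.31). THIS FILE proves the uniform statement for EVERY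
even `n` and EVERY non-self-dual pin, by the two-zero-pivot lemma of `Mod4TwoZeroPivots` applied to `N = T_f − μ_a`. ELEMENTARY LINEAR
ALGEBRA over a field ONLY: no abelian variety, no sheaf, no Ext group, no semiregularity map; nothing here says that HC / HC_CM / HC_AV
holds; no Literature fact is declared; NO definition is introduced.

SETTING: `n = a + k + a` even (so `k = n − 2a` is even), `q_m = 0` for `m < n`, `q_n ≠ 0`, any tail `q_{n+1}, …, q_{2n}`;
`μ = (−1)^a C(n,a) q_n`, `t = (−1)ⁿ C(n,a)² q_n²`; by `Mod4LeadingTermPinsEven`, `dim ker(M_f − t) = dim ker(T_f − μ)`, and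
`N := T_f − μ` is upper triangular with zero pivots EXACTLY at `a` and `a + k = n − a`.  The **pin block** is the `k × k` matrix
`B = (N_{a+r, a+1+s})_{r,s<k}` (rows `a, …, n−a−1`, columns `a+1, …, n−a`; a hypothesis `hB : B = Matrix.of …`, no definition), with
entries `B_{rs} = (−1)^{a+1+s} C(n,a+1+s) q_{n+1+s−r} − [r = s+1]·μ` (`pinBlock_apply`): affine in the top coefficient `q_{2n−2a}`.
WHAT IS PROVED:
* **`hankelT_sub_pin_diag`** — the pivots of `T_f − μ_a`: zero at `a` and `n − a`, non-zero elsewhere (`q_n ≠ 0`);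
* **`eq_zero_of_mem_ker_hankelT_pin`** — `det B ≠ 0`, `v ∈ ker(T_f − μ_a)`, `v_a = 0` ⇒ `v = 0`;
* **`finrank_ker_middleM_leading_pin_of_det_ne_zero`** — `det B ≠ 0` ⇒ `dim ker(M_f − t_a) = 1`;
* **`finrank_ker_middleM_leading_pin_of_det_eq_zero`** — `det B = 0` ⇒ `dim ker(M_f − t_a) = 2`;
* **`finrank_ker_middleM_leading_pin_eq_two_iff`** — `dim ker(M_f − t_a) = 2 ↔ det B = 0` (else the dimension is `1`:
  `Mod4LeadingTermPins` brackets it in `[1, 2]`);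
* **`pinBlock_apply`** (the entries of the pin block) and CONSISTENCY with FILE 48 (`k = 2`, the pin next to the self-dual one):
  **`det_pinBlock_two`** — `det B = C(n,a+2)·(C(n+1,a+1) q_n q_{n+2} − C(n,a+1) q_{n+1}²)`.
So for every even `n` the middle entry of a `ch(O_Z)`-shape row of TABLE R at the pin `C(n,a)²q_n²` (`a < n/2`) is
`(n+3)C(2n,n) − 2(n+1) − 2` ON the hypersurface `det B_a(q_n, …, q_{2n−2a}) = 0` and `− 1` OFF it (`n = 4`, `a = 0`: `det B₀` is
minus the weight-20 quartic of FILE 43 (machine check); `a = n/2 − 1`: FILE 48's condition times `C(n,n/2+1)`).  Everything PROVED,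
0 sorry. Namespace `Summit.Ventures.HSemireg.Mod4`. References: [BourbakiAlgebre1a3] Ch. III §8; [BuchweitzFlenner2008HH] Prop. 6.4.4
(why these matrices).
-/

namespace Summit.Ventures.HSemireg.Mod4

open Finset Matrix

variable {K : Type*} [Field K]

/-! ### The pin criterion for the `ch(O_Z)`-shapes: `N = T_f − μ_a`, `i = a`, `k = n − 2a` -/

/-- the pivots of `N = T_f(q) − μ_a` for a leading shape (`q_m = 0`, `m < n`; `n = a + k + a` even, `μ_a = (−1)^a C(n,a) q_n`):
upper triangular, `N_{aa} = N_{n−a,n−a} = 0`, and `N_{bb} ≠ 0` for `b ∉ {a, n − a}` when `q_n ≠ 0`.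
[cite: BourbakiAlgebre1a3, Ch. III §8] -/
theorem hankelT_sub_pin_diag [CharZero K] {n a k : ℕ} (hn : n = a + k + a) (heven : Even n) {q : ℕ → K}
    (hqn : q n ≠ 0) {μ : K} (hμ : μ = (-1 : K) ^ a * (n.choose a : K) * q n) :
    (hankelT n q - μ • (1 : Matrix (Fin (n + 1)) (Fin (n + 1)) K)) ⟨a, by omega⟩ ⟨a, by omega⟩ = 0 ∧
    (hankelT n q - μ • (1 : Matrix (Fin (n + 1)) (Fin (n + 1)) K)) ⟨a + k, by omega⟩ ⟨a + k, by omega⟩ = 0 ∧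
    ∀ b : Fin (n + 1), (b : ℕ) ≠ a → (b : ℕ) ≠ a + k →
      (hankelT n q - μ • (1 : Matrix (Fin (n + 1)) (Fin (n + 1)) K)) b b ≠ 0 := by
  have hdiag : ∀ b : Fin (n + 1), (hankelT n q - μ • (1 : Matrix (Fin (n + 1)) (Fin (n + 1)) K)) b b =
      (-1 : K) ^ (b : ℕ) * (n.choose (b : ℕ) : K) * q n - μ := by
    intro b
    have hb := b.isLt
    rw [Matrix.sub_apply, Matrix.smul_apply, Matrix.one_apply_eq, smul_eq_mul, mul_one, hankelT_apply,
      show n - (b : ℕ) + (b : ℕ) = n by omega]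
  refine ⟨?_, ?_, ?_⟩
  · rw [hdiag, hμ]
    exact sub_self _
  · have hk : Even k := by
      obtain ⟨r, hr⟩ := heven
      exact ⟨r - a, by omega⟩
    rw [hdiag, hμ, show ((⟨a + k, by omega⟩ : Fin (n + 1)) : ℕ) = a + k from rfl,
      show n.choose (a + k) = n.choose a from Nat.choose_symm_of_eq_add (by omega), pow_add, hk.neg_one_pow, mul_one, sub_self]
  · intro b hba hbk
    rw [hdiag, hμ]
    exact hankelT_leading_diag_sub_ne_zero hqn (Nat.le_of_lt_succ b.isLt) (by omega) (by omega)

/-- **generic pin block ⇒ injectivity of `v ↦ v_a` on `ker(T_f − μ_a)`:** for a leading shape (`q_m = 0`, `m < n`, `q_n ≠ 0`,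
`n = a + k + a` even) and `det B ≠ 0`, `B = ((T_f − μ_a)_{a+r, a+1+s})_{r,s<k}`, a kernel vector of `T_f − μ_a` with `v_a = 0`
vanishes. [cite: BourbakiAlgebre1a3, Ch. III §8] -/
theorem eq_zero_of_mem_ker_hankelT_pin [CharZero K] {n a k : ℕ} (hn : n = a + k + a) (heven : Even n) {q : ℕ → K}
    (hq0 : ∀ m, m < n → q m = 0) (hqn : q n ≠ 0) {μ : K} (hμ : μ = (-1 : K) ^ a * (n.choose a : K) * q n)
    {B : Matrix (Fin k) (Fin k) K}
    (hB : B = Matrix.of fun r s : Fin k =>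
      (hankelT n q - μ • (1 : Matrix (Fin (n + 1)) (Fin (n + 1)) K)) ⟨a + r, by omega⟩ ⟨a + 1 + s, by omega⟩)
    (hdet : B.det ≠ 0) {v : Fin (n + 1) → K} (hv : v ∈ LinearMap.ker (Matrix.toLin' (hankelT n q) - μ • LinearMap.id))
    (hva : v ⟨a, by omega⟩ = 0) : v = 0 := by
  rw [toLin'_sub_smul_id, LinearMap.mem_ker, Matrix.toLin'_apply] at hv
  obtain ⟨-, -, hpiv⟩ := hankelT_sub_pin_diag hn heven hqn hμ
  exact eq_zero_of_mulVec_eq_zero_of_det_pinBlock_ne_zero (blockTriangular_hankelT_leading_sub hq0 μ) (by omega) hpiv hB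
    hdet hv hva

/-- **THE PIN CRITERION, GENERIC HALF — EVERY EVEN `n`, EVERY PIN `a < n/2`:** for `q_m = 0` (`m < n`), `q_n ≠ 0`, `n = a + k + a`
even, `t = (−1)ⁿ C(n,a)² q_n²` and `det B ≠ 0` (`B` the `k × k` pin block of `T_f − μ_a`): `dim ker(M_f(q) − t) = 1`.
[cite: BourbakiAlgebre1a3, Ch. III §8] [cite: BuchweitzFlenner2008HH, Prop. 6.4.4] -/
theorem finrank_ker_middleM_leading_pin_of_det_ne_zero [CharZero K] {n a k : ℕ} (hn : n = a + k + a) (heven : Even n)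
    {q : ℕ → K} (hq0 : ∀ m, m < n → q m = 0) (hqn : q n ≠ 0) {μ t : K} (hμ : μ = (-1 : K) ^ a * (n.choose a : K) * q n)
    (ht : t = (-1 : K) ^ n * ((n.choose a : K) * (n.choose a : K)) * (q n * q n))
    {B : Matrix (Fin k) (Fin k) K}
    (hB : B = Matrix.of fun r s : Fin k =>
      (hankelT n q - μ • (1 : Matrix (Fin (n + 1)) (Fin (n + 1)) K)) ⟨a + r, by omega⟩ ⟨a + 1 + s, by omega⟩)
    (hdet : B.det ≠ 0) :
    Module.finrank K ↥(LinearMap.ker (Matrix.toLin' (middleM n q) - t • LinearMap.id)) = 1 := by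
  refine le_antisymm ?_ (one_le_finrank_ker_middleM_leading_pin hq0 (by omega) ht)
  rw [finrank_ker_middleM_leading_pin_even heven hq0 hqn (a := a) (by omega) hμ ht]
  set W := LinearMap.ker (Matrix.toLin' (hankelT n q) - μ • LinearMap.id) with hW
  let f : ↥W →ₗ[K] K := (LinearMap.proj (⟨a, by omega⟩ : Fin (n + 1))) ∘ₗ W.subtype
  have hf : Function.Injective f := by
    rw [← LinearMap.ker_eq_bot, LinearMap.ker_eq_bot']
    intro v hv
    have hva : (v : Fin (n + 1) → K) ⟨a, by omega⟩ = 0 := by simpa [f] using hv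
    exact Subtype.ext (eq_zero_of_mem_ker_hankelT_pin hn heven hq0 hqn hμ hB hdet v.2 hva)
  have h := LinearMap.finrank_le_finrank_of_injective hf
  rwa [Module.finrank_self] at h

/-- **THE PIN CRITERION, DEGENERATE HALF — EVERY EVEN `n`, EVERY PIN `a < n/2`:** for `q_m = 0` (`m < n`), `q_n ≠ 0`,
`n = a + k + a` even, `t = (−1)ⁿ C(n,a)² q_n²` and `det B = 0` (`B` the `k × k` pin block of `T_f − μ_a`): `dim ker(M_f(q) − t) = 2`.
[cite: BourbakiAlgebre1a3, Ch. III §8] [cite: BuchweitzFlenner2008HH, Prop. 6.4.4] -/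
theorem finrank_ker_middleM_leading_pin_of_det_eq_zero [CharZero K] {n a k : ℕ} (hn : n = a + k + a) (heven : Even n)
    {q : ℕ → K} (hq0 : ∀ m, m < n → q m = 0) (hqn : q n ≠ 0) {μ t : K} (hμ : μ = (-1 : K) ^ a * (n.choose a : K) * q n)
    (ht : t = (-1 : K) ^ n * ((n.choose a : K) * (n.choose a : K)) * (q n * q n))
    {B : Matrix (Fin k) (Fin k) K}
    (hB : B = Matrix.of fun r s : Fin k =>
      (hankelT n q - μ • (1 : Matrix (Fin (n + 1)) (Fin (n + 1)) K)) ⟨a + r, by omega⟩ ⟨a + 1 + s, by omega⟩)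
    (hdet : B.det = 0) :
    Module.finrank K ↥(LinearMap.ker (Matrix.toLin' (middleM n q) - t • LinearMap.id)) = 2 := by
  refine le_antisymm (finrank_ker_middleM_leading_pin_le_two hq0 hqn (by omega) ht) ?_
  rw [finrank_ker_middleM_leading_pin_even heven hq0 hqn (a := a) (by omega) hμ ht, toLin'_sub_smul_id]
  obtain ⟨hNa, hNak, hpiv⟩ := hankelT_sub_pin_diag hn heven hqn hμ
  exact two_le_finrank_ker_of_det_pinBlock_eq_zero (blockTriangular_hankelT_leading_sub hq0 μ) (by omega) hpiv hNa hNak hB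
    hdet

/-- **THE PIN CRITERION — EVERY EVEN `n`, EVERY PIN `a < n/2`:** `dim ker(M_f(q) − t_a) = 2 ↔ det B = 0` (else the dimension is
`1`), `B` the `k × k` pin block of `T_f − μ_a`, `k = n − 2a`. [cite: BourbakiAlgebre1a3, Ch. III §8]
[cite: BuchweitzFlenner2008HH, Prop. 6.4.4] -/
theorem finrank_ker_middleM_leading_pin_eq_two_iff [CharZero K] {n a k : ℕ} (hn : n = a + k + a) (heven : Even n)
    {q : ℕ → K} (hq0 : ∀ m, m < n → q m = 0) (hqn : q n ≠ 0) {μ t : K} (hμ : μ = (-1 : K) ^ a * (n.choose a : K) * q n)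
    (ht : t = (-1 : K) ^ n * ((n.choose a : K) * (n.choose a : K)) * (q n * q n))
    {B : Matrix (Fin k) (Fin k) K}
    (hB : B = Matrix.of fun r s : Fin k =>
      (hankelT n q - μ • (1 : Matrix (Fin (n + 1)) (Fin (n + 1)) K)) ⟨a + r, by omega⟩ ⟨a + 1 + s, by omega⟩) :
    Module.finrank K ↥(LinearMap.ker (Matrix.toLin' (middleM n q) - t • LinearMap.id)) = 2 ↔ B.det = 0 := by
  constructor
  · intro h
    by_contra hdet
    rw [finrank_ker_middleM_leading_pin_of_det_ne_zero hn heven hq0 hqn hμ ht hB hdet] at h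
    exact absurd h (by norm_num)
  · exact finrank_ker_middleM_leading_pin_of_det_eq_zero hn heven hq0 hqn hμ ht hB

/-- the entries of the pin block of `T_f(q) − μ`: `B_{rs} = (−1)^{a+1+s} C(n,a+1+s) q_{n+1+s−r} − [r = s+1]·μ`
(`n = a + k + a`; for a leading shape the entries with `r > s + 1` vanish as `q_{<n} = 0`). [cite: BourbakiAlgebre1a3, Ch. III §8] -/
theorem pinBlock_apply {n a k : ℕ} (hn : n = a + k + a) (q : ℕ → K) (μ : K) {B : Matrix (Fin k) (Fin k) K}
    (hB : B = Matrix.of fun r s : Fin k =>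
      (hankelT n q - μ • (1 : Matrix (Fin (n + 1)) (Fin (n + 1)) K)) ⟨a + r, by omega⟩ ⟨a + 1 + s, by omega⟩)
    (r s : Fin k) :
    B r s = (-1 : K) ^ (a + 1 + s) * (n.choose (a + 1 + s) : K) * q (n + 1 + s - r) -
      if (r : ℕ) = (s : ℕ) + 1 then μ else 0 := by
  have hr := r.isLt
  have hs := s.isLt
  rw [hB, Matrix.of_apply, Matrix.sub_apply, Matrix.smul_apply, hankelT_apply, Matrix.one_apply, smul_eq_mul, mul_ite,
    mul_one, mul_zero]
  simp only [Fin.mk.injEq]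
  rw [show n - (a + (r : ℕ)) + (a + 1 + (s : ℕ)) = n + 1 + (s : ℕ) - (r : ℕ) by omega]
  by_cases h : (r : ℕ) = (s : ℕ) + 1
  · rw [if_pos (by omega), if_pos h]
  · rw [if_neg (by omega), if_neg h]

/-- **consistency with the near-self-dual criterion (`k = 2`):** the `2 × 2` pin block of `T_f − μ_a` for `n = a + 2 + a` has
`det B = C(n,a+2)·(C(n+1,a+1)·q_n·q_{n+2} − C(n,a+1)·q_{n+1}²)` — `Mod4LeadingTermPinsNearSelfDual`'s hypersurface.
[cite: BourbakiAlgebre1a3, Ch. III §8] -/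
theorem det_pinBlock_two {n a : ℕ} (hn : n = a + 2 + a) {q : ℕ → K} {μ : K} (hμ : μ = (-1 : K) ^ a * (n.choose a : K) * q n)
    {B : Matrix (Fin 2) (Fin 2) K}
    (hB : B = Matrix.of fun r s : Fin 2 =>
      (hankelT n q - μ • (1 : Matrix (Fin (n + 1)) (Fin (n + 1)) K)) ⟨a + r, by omega⟩ ⟨a + 1 + s, by omega⟩) :
    B.det = (n.choose (a + 2) : K) *
      (((n + 1).choose (a + 1) : K) * q n * q (n + 2) - (n.choose (a + 1) : K) * (q (n + 1) * q (n + 1))) := by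
  rw [Matrix.det_fin_two, pinBlock_apply hn q μ hB, pinBlock_apply hn q μ hB, pinBlock_apply hn q μ hB,
    pinBlock_apply hn q μ hB]
  simp only [Fin.val_zero, Fin.val_one]
  norm_num
  rw [hμ, show n + 1 + 1 = n + 2 from rfl, show a + 1 + 1 = a + 2 from rfl,
    show (n.choose a : K) = ((n + 1).choose (a + 1) : K) - (n.choose (a + 1) : K) by
      rw [Nat.choose_succ_succ' n a]; push_cast; ring]
  have hsq : ((-1 : K) ^ a) * ((-1 : K) ^ a) = 1 := by rw [← pow_add, ← two_mul, pow_mul, neg_one_sq, one_pow]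
  linear_combination ((n.choose (a + 2) : K) *
    (((n + 1).choose (a + 1) : K) * q n * q (n + 2) - (n.choose (a + 1) : K) * (q (n + 1) * q (n + 1)))) * hsq

end Summit.Ventures.HSemireg.Mod4
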